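import Mathlib.Analysis.InnerProductSpace.Basic
import Mathlib.Analysis.InnerProductSpace.Continuous
import Mathlib.Analysis.Normed.Operator.Extend
import Mathlib.LinearAlgebra.Finsupp.LinearCombination
import HarnessLib

/-!
# Anti-unitary operators from Gram data

Topic `Analysis/InnerProduct`; namespace `Literature.Analysis.InnerProduct`.

Let `H` be a complex Hilbert space and `x, y : T → H` two families with *conjugate Gram data*,
`⟪y s, y t⟫ = ⟪x t, x s⟫` for all `s, t`, the family `x` being total (its span is dense). Then
there is a unique bounded CONJUGATE-LINEAR operator `J` on `H` with `J (x t) = y t`; it satisfies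
`⟪J v, J w⟫ = ⟪w, v⟫` (an anti-isometry), and more generally, for every bounded operator `A`
with `⟪y t, A (y s)⟫ = ⟪x s, A (x t)⟫ for all `s, t`, one has `⟪J v, A (J w)⟫ = ⟪w, A v⟫ for all
`v, w` (`inner_gramAntilinear_apply_apply`). If `y` is total as well, the operator built from the
swapped data is a two-sided inverse (`gramAntilinear_gramAntilinear`), so `J` is an anti-unitary.

This is the standard construction of the anti-unitary "`J̲ = J|_H`" attached to a symmetric
invariant Hilbert subspace in E. G. F. Thomas's proof of the multiplicity-free criterion for
generalised Gelfand pairs (*The theorem of Bochner–Schwartz–Godement for generalised Gelfand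
pairs* (1984), Thm. E); we build it with Mathlib's `LinearMap.extendOfNorm` (extension of the
densely defined conjugate-linear map `Σ c_t x_t ↦ Σ conj(c_t) y_t`, which is norm preserving by
the Gram identity) — no choice of values on a span is needed.

## Main definitions and results

* `gramAntilinear x y : H →SL[starRingEnd ℂ] H` — the operator (junk unless `x` is total and the
  Gram identity holds);
* `gramAntilinear_apply` — `gramAntilinear x y (x t) = y t`;
* `inner_gramAntilinear_apply_apply` — `⟪J v, A (J w)⟫ = ⟪w, A v⟫` from the identity on the
  families; `inner_gramAntilinear_gramAntilinear` — `⟪J v, J w⟫ = ⟪w, v⟫`;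
* `gramAntilinear_gramAntilinear` — `gramAntilinear y x (gramAntilinear x y v) = v` when both
  families are total.

## References

* E. G. F. Thomas, *The theorem of Bochner–Schwartz–Godement for generalised Gelfand pairs*, in:
  Functional Analysis: Surveys and Recent Results III, North-Holland Math. Studies 90 (1984),
  291–304, proof of Thm. E.
* L. Schwartz, *Sous-espaces hilbertiens d'espaces vectoriels topologiques et noyaux associés*,
  J. Analyse Math. 13 (1964), §§1–2.
-/

noncomputable section

open scoped InnerProductSpace ComplexConjugate

namespace Literature.Analysis.InnerProduct

variable {H : Type*} [NormedAddCommGroup H] [InnerProductSpace ℂ H] {T : Type*}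

/-! ### 1. The finitely supported combinations `Σ c_t x_t` and `Σ conj(c_t) y_t` -/

/-- `Φ_x c = Σ_t c_t • x_t` (Mathlib's `Finsupp.linearCombination`). [folklore] -/
abbrev gramComb (x : T → H) : (T →₀ ℂ) →ₗ[ℂ] H := Finsupp.linearCombination ℂ x

/-- `Ψ_y c = Σ_t conj(c_t) • y_t`, a conjugate-linear map. [folklore] -/
def gramConjComb (y : T → H) : (T →₀ ℂ) →ₛₗ[starRingEnd ℂ] H where
  toFun c := c.sum fun t a => conj a • y t
  map_add' c d := by
    rw [Finsupp.sum_add_index']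
    · intro t
      rw [map_zero, zero_smul]
    · intro t a b
      rw [map_add, add_smul]
  map_smul' r c := by
    rw [Finsupp.sum_smul_index']
    · rw [Finsupp.smul_sum]
      refine Finsupp.sum_congr fun t _ => ?_
      rw [smul_eq_mul, map_mul, mul_smul]
    · intro t
      rw [map_zero, zero_smul]

/-- Unfolding of `Φ_x`. [folklore] -/
theorem gramComb_apply (x : T → H) (c : T →₀ ℂ) : gramComb x c = c.sum fun t a => a • x t :=
  Finsupp.linearCombination_apply ℂ c

/-- Unfolding of `Ψ_y`. [folklore] -/
theorem gramConjComb_apply (y : T → H) (c : T →₀ ℂ) :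
    gramConjComb y c = c.sum fun t a => conj a • y t := rfl

/-- `Φ_x (δ_t a) = a • x t`. [folklore] -/
@[simp] theorem gramComb_single (x : T → H) (t : T) (a : ℂ) : gramComb x (Finsupp.single t a) = a • x t := by
  rw [gramComb_apply, Finsupp.sum_single_index]
  exact zero_smul ℂ _

/-- `Ψ_y (δ_t a) = conj a • y t`. [folklore] -/
@[simp] theorem gramConjComb_single (y : T → H) (t : T) (a : ℂ) :
    gramConjComb y (Finsupp.single t a) = conj a • y t := by
  rw [gramConjComb_apply, Finsupp.sum_single_index]
  rw [map_zero, zero_smul]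

/-- **The twisted Gram identity on finite combinations**: if `⟪y t, A (y s)⟫ = ⟪x s, A (x t)⟫` for
all `s, t`, then `⟪Ψ_y c, A (Ψ_y d)⟫ = ⟪Φ_x d, A (Φ_x c)⟫`. [folklore] -/
theorem inner_gramConjComb_apply_gramConjComb {x y : T → H} (A : H →L[ℂ] H)
    (hA : ∀ s t : T, ⟪y t, A (y s)⟫_ℂ = ⟪x s, A (x t)⟫_ℂ) (c d : T →₀ ℂ) :
    ⟪gramConjComb y c, A (gramConjComb y d)⟫_ℂ = ⟪gramComb x d, A (gramComb x c)⟫_ℂ := by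
  rw [gramConjComb_apply, gramConjComb_apply, gramComb_apply, gramComb_apply]
  simp only [Finsupp.sum, map_sum, sum_inner, inner_sum, inner_smul_left, inner_smul_right,
    map_smul, Complex.conj_conj, Finset.mul_sum]
  rw [Finset.sum_comm]
  refine Finset.sum_congr rfl fun s _ => Finset.sum_congr rfl fun t _ => ?_
  rw [hA t s]
  ring

/-- The Gram identity: `‖Ψ_y c‖ = ‖Φ_x c‖` when `⟪y s, y t⟫ = ⟪x t, x s⟫`. [folklore] -/
theorem norm_gramConjComb_eq {x y : T → H} (hGram : ∀ s t : T, ⟪y s, y t⟫_ℂ = ⟪x t, x s⟫_ℂ)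
    (c : T →₀ ℂ) : ‖gramConjComb y c‖ = ‖gramComb x c‖ := by
  have h := inner_gramConjComb_apply_gramConjComb (x := x) (y := y) (ContinuousLinearMap.id ℂ H)
    (fun s t => by simpa using hGram t s) c c
  simp only [ContinuousLinearMap.id_apply] at h
  rw [norm_eq_sqrt_re_inner (𝕜 := ℂ), norm_eq_sqrt_re_inner (𝕜 := ℂ), h]


/-- `Ψ_y c = Φ_y (conj ∘ c)`. [folklore] -/
theorem gramConjComb_eq_gramComb_mapRange (y : T → H) (c : T →₀ ℂ) :
    gramConjComb y c = gramComb y (c.mapRange (starRingEnd ℂ) (map_zero _)) := by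
  rw [gramConjComb_apply, gramComb_apply, Finsupp.sum_mapRange_index]
  intro t
  exact zero_smul ℂ _

/-- `Ψ_x (conj ∘ c) = Φ_x c`. [folklore] -/
theorem gramConjComb_mapRange (x : T → H) (c : T →₀ ℂ) :
    gramConjComb x (c.mapRange (starRingEnd ℂ) (map_zero _)) = gramComb x c := by
  rw [gramConjComb_apply, gramComb_apply, Finsupp.sum_mapRange_index]
  · refine Finsupp.sum_congr fun t _ => ?_
    rw [Complex.conj_conj]
  · intro t
    rw [map_zero, zero_smul]

/-- Totality of `x` as density of the range of `Φ_x`. [folklore] -/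
theorem denseRange_gramComb {x : T → H} (hx : Dense (Submodule.span ℂ (Set.range x) : Set H)) :
    DenseRange (gramComb x) := by
  change Dense (Set.range (gramComb x))
  rwa [← LinearMap.coe_range, gramComb, Finsupp.range_linearCombination]

/-! ### 2. The conjugate-linear operator `J` with `J (x t) = y t` -/

variable [CompleteSpace H]

/-- **The conjugate-linear operator attached to conjugate Gram data**: the continuous extension of
the densely defined, norm preserving, conjugate-linear map `Σ c_t x_t ↦ Σ conj(c_t) y_t`
(Mathlib's `LinearMap.extendOfNorm`). Junk unless `x` is total and `⟪y s, y t⟫ = ⟪x t, x s⟫`.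
[folklore] -/
def gramAntilinear (x y : T → H) : H →SL[starRingEnd ℂ] H :=
  (gramConjComb y).extendOfNorm (gramComb x)

variable {x y : T → H}

omit [CompleteSpace H] in
/-- The norm bound feeding `extendOfNorm`: `‖Ψ_y c‖ ≤ 1 · ‖Φ_x c‖`. [folklore] -/
theorem norm_gramConjComb_le (hGram : ∀ s t : T, ⟪y s, y t⟫_ℂ = ⟪x t, x s⟫_ℂ) :
    ∃ C : ℝ, ∀ c : T →₀ ℂ, ‖gramConjComb y c‖ ≤ C * ‖gramComb x c‖ :=
  ⟨1, fun c => by rw [norm_gramConjComb_eq hGram, one_mul]⟩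

/-- `J (Φ_x c) = Ψ_y c` on finite combinations. [folklore] -/
theorem gramAntilinear_gramComb (hx : Dense (Submodule.span ℂ (Set.range x) : Set H))
    (hGram : ∀ s t : T, ⟪y s, y t⟫_ℂ = ⟪x t, x s⟫_ℂ) (c : T →₀ ℂ) :
    gramAntilinear x y (gramComb x c) = gramConjComb y c :=
  LinearMap.extendOfNorm_eq (denseRange_gramComb hx) (norm_gramConjComb_le hGram) c

/-- **`J (x t) = y t`.** [folklore] -/
theorem gramAntilinear_apply (hx : Dense (Submodule.span ℂ (Set.range x) : Set H))
    (hGram : ∀ s t : T, ⟪y s, y t⟫_ℂ = ⟪x t, x s⟫_ℂ) (t : T) :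
    gramAntilinear x y (x t) = y t := by
  have h := gramAntilinear_gramComb hx hGram (Finsupp.single t 1)
  rwa [gramComb_single, one_smul, gramConjComb_single, map_one, one_smul] at h

/-- **The twisted anti-isometry identity**: if `⟪y t, A (y s)⟫ = ⟪x s, A (x t)⟫` on the families,
then `⟪J v, A (J w)⟫ = ⟪w, A v⟫` for all `v, w` (density of `x` twice, continuity).
[cite: Thomas1984GelfandPairs, proof of Thm. E] -/
theorem inner_gramAntilinear_apply_apply (hx : Dense (Submodule.span ℂ (Set.range x) : Set H))
    (hGram : ∀ s t : T, ⟪y s, y t⟫_ℂ = ⟪x t, x s⟫_ℂ) (A : H →L[ℂ] H)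
    (hA : ∀ s t : T, ⟪y t, A (y s)⟫_ℂ = ⟪x s, A (x t)⟫_ℂ) (v w : H) :
    ⟪gramAntilinear x y v, A (gramAntilinear x y w)⟫_ℂ = ⟪w, A v⟫_ℂ := by
  have hd := denseRange_gramComb hx
  -- stage 1: `w` a finite combination
  have stage1 : ∀ (d : T →₀ ℂ) (v : H),
      ⟪gramAntilinear x y v, A (gramConjComb y d)⟫_ℂ = ⟪gramComb x d, A v⟫_ℂ := by
    intro d v
    refine hd.induction_on (p := fun v => ⟪gramAntilinear x y v, A (gramConjComb y d)⟫_ℂ =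
      ⟪gramComb x d, A v⟫_ℂ) v ?_ ?_
    · exact isClosed_eq ((gramAntilinear x y).continuous.inner continuous_const)
        (continuous_const.inner A.continuous)
    · intro c
      rw [gramAntilinear_gramComb hx hGram, inner_gramConjComb_apply_gramConjComb A hA]
  -- stage 2: general `w`
  refine hd.induction_on (p := fun w => ⟪gramAntilinear x y v, A (gramAntilinear x y w)⟫_ℂ =
    ⟪w, A v⟫_ℂ) w ?_ ?_
  · exact isClosed_eq (continuous_const.inner (A.continuous.comp (gramAntilinear x y).continuous))
      (continuous_id.inner continuous_const)
  · intro d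
    rw [gramAntilinear_gramComb hx hGram, stage1]

/-- **`J` is an anti-isometry**: `⟪J v, J w⟫ = ⟪w, v⟫`. [folklore] -/
theorem inner_gramAntilinear_gramAntilinear (hx : Dense (Submodule.span ℂ (Set.range x) : Set H))
    (hGram : ∀ s t : T, ⟪y s, y t⟫_ℂ = ⟪x t, x s⟫_ℂ) (v w : H) :
    ⟪gramAntilinear x y v, gramAntilinear x y w⟫_ℂ = ⟪w, v⟫_ℂ := by
  simpa using inner_gramAntilinear_apply_apply hx hGram (ContinuousLinearMap.id ℂ H)
    (fun s t => by simpa using hGram t s) v w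

/-- **Anti-unitarity**: if `y` is total as well, the operator built from the swapped data inverts
`J`: `J' (J v) = v`. [folklore] -/
theorem gramAntilinear_gramAntilinear (hx : Dense (Submodule.span ℂ (Set.range x) : Set H))
    (hy : Dense (Submodule.span ℂ (Set.range y) : Set H))
    (hGram : ∀ s t : T, ⟪y s, y t⟫_ℂ = ⟪x t, x s⟫_ℂ) (v : H) :
    gramAntilinear y x (gramAntilinear x y v) = v := by
  have hGram' : ∀ s t : T, ⟪x s, x t⟫_ℂ = ⟪y t, y s⟫_ℂ := fun s t => (hGram t s).symm
  refine (denseRange_gramComb hx).induction_on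
    (p := fun v => gramAntilinear y x (gramAntilinear x y v) = v) v ?_ ?_
  · exact isClosed_eq ((gramAntilinear y x).continuous.comp (gramAntilinear x y).continuous)
      continuous_id
  · intro c
    rw [gramAntilinear_gramComb hx hGram, gramConjComb_eq_gramComb_mapRange,
      gramAntilinear_gramComb hy hGram', gramConjComb_mapRange]

end Literature.Analysis.InnerProduct
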